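import Summits.ABC.IUTFork.Cor312ThetaSideClosedK
import HarnessLib

/-!
# [IUTchIII] Cor. 3.12 — the K-level READ binder is ALWAYS STRICT: `−|log(Θ)|(settingPrVolSharp (pilotDataOfK D K) …) ≤ ↑(nonarchimedean
# genuine −|log(Θ)|) < ↑(genuine −|log(Θ)|)` for every realising choice — the «(or =)» alternative of TARGET #2 is REFUTED at the K level

PROOF-ONLY file (D-0012; no definitions, no `Prop` facts) of the abc-iut cell (R2 S-chain team, seat abc-iut-s2-p7 gen 2, TARGET #2 `hΘ … (or =)`;
sequel of abc-iut-s2-p6's `Cor312ThetaSideClosedK` (p447368, the K-level `≤`) and of this seat's `Cor312ThetaSideContentBoundK` (p446007)).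
TAKES NO SIDE on [IUTchIII] Cor. 3.12.

The mint (director-abc R2, 2026-08-26T07:39:27Z) asked for «`(settingPrVolSharp …).negLogTheta ≤ ↑I.negLogTheta` (or =) for the realising ideles
of a volume input `I`». The `≤` is abc-iut-s2-p6's `negLogTheta_settingPrVolSharp_pilotDataOfK_le_genuine` (K level; M level: abc-iut-s2-p8
p440655). THIS FILE settles the «(or =)» at the K level IN THE KERNEL, in the negative, at EVERY datum and EVERY realising choice:

* **`negLogTheta_settingPrVolSharp_pilotDataOfK_le_negLogThetaNonarch`** — the SHARPER bound without the archimedean term: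
  `−|log(Θ)|(settingPrVolSharp (pilotDataOfK D K) …) ≤ ↑I.negLogThetaNonarch` (this seat's p446007 with `A := 0` on `Tp := T(I)`, abc-iut-s2-p6's
  per-prime identity `procAvg_sum_weightPr_content_below_eq_negLogThetaLoc`): abc-iut-c312-7's real setting carries the TRIVIAL archimedean
  container (abc-iut-c312-5/c312-1; local Θ-term `0` at `v_ℚ = ∞`, abc-iut-s2-p7 gen 0 `thetaLocal_settingPrVol_inl_eq_zero`), whereas abc-iut-S2's
  genuine number adds `archLogTheta l = ((l+5)/4)·log π` ([IUTchIV] Thm. 1.10 Step (vii));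
* **`negLogTheta_settingPrVolSharp_pilotDataOfK_lt_genuine`** / **`…_ne_genuine`** — hence `< ↑I.negLogTheta` and `≠ ↑I.negLogTheta`
  (`archLogTheta_pos`): the READ binder `hΘ` of v6K/v7K (and `hΘw` of the window certificates) holds with STRICT inequality at every datum; the
  two-sided «=» reading of TARGET #2 is false for THESE typings (it compares a number WITHOUT an archimedean summand to one WITH it);
* `…_lt_datum` / `…_le_negLogThetaNonarch_datum` — the same in the binder shape of the certificates (`T : Cor22.ThetaVolumeDatumAt P l`).
What stays OPEN here (abc-iut-s2-p9 MATH NOTE (N1), abc-iut-s2-p8 gen 3 at the M level): NONARCHIMEDEAN EXACTNESS, i.e. whether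
`−|log(Θ)|(settingPrVolSharp (pilotDataOfK D K) …) = ↑I.negLogThetaNonarch` (the reverse per-packet inequality = the orbit-span statement for the
setting's (Ind2)); nothing in this file bears on it.

[cite: Mochizuki2012, IUTchIII Cor. 3.12 p. 173–174] [cite: Mochizuki2012, IUTchIV Thm. 1.10 Steps (v)–(viii) p. 27–30]
[cite: DupuyHilado2025, §1 (1.1), Def. 3.6.3, §4.12] [claim: Mochizuki2012, status: disputed] for every quoted construction. HONEST FRAMING: a
comparison of OUR two typed `−|log(Θ)|`'s of one datum (all-places sharp setting with trivial archimedean container vs. section number with the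
printed archimedean closed form); nothing here asserts or denies Cor. 3.12 for any initial Θ-data or takes a side on any author; typed ≠ proved.
-/

noncomputable section

open Set Function NumberField IsDedekindDomain
open scoped Pointwise

namespace Summit.ABC.IUTFork.Cor312Prov

open Cor312 Cor312Vol Literature.IUT.LogThetaLattice Literature.IUT.LogVolume
  Literature.IUT.HodgeTheaters Literature.IUT.LogVolume.ThetaData Literature.NumberTheory.NumberFields
open Thm311.Real hiding finBelow

variable {F K Fbar : Type} [Field F] [NumberField F] [Field K] [NumberField K] [Algebra F K] [Field Fbar]
  [Algebra F Fbar] [Algebra K Fbar] {E : WeierstrassCurve F} [E.IsElliptic] {l : ℕ} {Pb : BadPlacePredicates K}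
  (D : InitialThetaData F K Fbar E l Pb)

/-- abc-iut-s2-p7 gen 0's closure set (p438921: the prime divisors of `2·disc K` and the primes under `S_K`) lies in abc-iut-S2's support `T(I)`
of any genuine input of `D`: a prime under a bad place `w ∈ S_K` is the residue characteristic of the bad place `w ∩ 𝓞_{F_mod} ∈ V^bad_mod`.
[cite: Mochizuki2012, IUTchIV Thm. 1.10 Step (vi) p. 29] [cite: DupuyHilado2025, §3.9] -/
theorem mem_supportPrimes_of_dvd_or_mem (r : IdeleData D) (pp : Nat.Primes)
    (h : (pp : ℕ) ∣ 2 * (NumberField.discr K).natAbs ∨ ∃ v ∈ (pilotDataOfK D K).S, ((pp : ℕ) : 𝓞 K) ∈ v.asIdeal) :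
    (pp : ℕ) ∈ (volumeInputOf D r).supportPrimes := by
  rcases h with h | ⟨v, hvS, hv⟩
  · exact Finset.mem_union_left _ (Nat.mem_primeFactors.mpr
      ⟨pp.2, h, mul_ne_zero two_ne_zero (Int.natAbs_ne_zero.mpr (NumberField.discr_ne_zero K))⟩)
  · haveI : Fact (pp : ℕ).Prime := ⟨pp.2⟩
    have hu : finBelow (fieldOfModuli E) K v ∈ (pilotData D).S := (mem_S_pilotDataOfK_iff_finBelow_mem D v).mp hvS
    have hpu : ((pp : ℕ) : 𝓞 (fieldOfModuli E)) ∈ (finBelow (fieldOfModuli E) K v).asIdeal := by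
      change ((pp : ℕ) : 𝓞 (fieldOfModuli E)) ∈ Ideal.comap (algebraMap (𝓞 (fieldOfModuli E)) (𝓞 K)) v.asIdeal
      rw [Ideal.mem_comap, map_natCast]
      exact hv
    have hres : residueChar (fieldOfModuli E) (finBelow (fieldOfModuli E) K v) = pp :=
      residueChar_eq_of_natCast_mem pp.1 hpu
    have key := (volumeInputOf D r).residueChar_mem_supportPrimes hu
    rwa [hres] at key

section Strict

variable (M : Type) [Field M] [NumberField M]
  (archPk : ∀ (j : (thetaIndex (pilotDataOfK D K)).Label) (vQ : (thetaIndex (pilotDataOfK D K)).VQ),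
    Set ((logShellsDH (pilotDataOfK D K) (analyticLogv K)).Packet j vQ))
  (archSub : ∀ (j : (thetaIndex (pilotDataOfK D K)).Label) (v : (thetaIndex (pilotDataOfK D K)).V),
    Set ((logShellsDH (pilotDataOfK D K) (analyticLogv K)).Packet j ((thetaIndex (pilotDataOfK D K)).over v)))
  (Ψ : ℤ → ∀ v : (thetaIndex (pilotDataOfK D K)).V, v ∈ (thetaIndex (pilotDataOfK D K)).Vbad →
    Set ((logShellsDH (pilotDataOfK D K) (analyticLogv K)).StarPacket v))
  (act : ℤ → ∀ v : (thetaIndex (pilotDataOfK D K)).V, v ∈ (thetaIndex (pilotDataOfK D K)).Vbad →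
    (logShellsDH (pilotDataOfK D K) (analyticLogv K)).StarPacket v →
      Module.End ℚ ((logShellsDH (pilotDataOfK D K) (analyticLogv K)).StarPacket v))
  (Mmod : ℤ → ∀ j : (thetaIndex (pilotDataOfK D K)).LabelStar,
    Set ((logShellsDH (pilotDataOfK D K) (analyticLogv K)).GlobalPacket j.1))
  (region : ℤ → ∀ j : (thetaIndex (pilotDataOfK D K)).LabelStar, FinDivisor M → ∀ vQ : (thetaIndex (pilotDataOfK D K)).VQ,
    Set ((logShellsDH (pilotDataOfK D K) (analyticLogv K)).Packet j.1 vQ))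
  (n : ℤ) {HT : Type} {LogLink : HT → HT → Type} {IsFull : ∀ {s t : HT}, LogLink s t → Prop}
  (lat : LGPGaussianLogThetaLattice LogLink IsFull)
  {Frd : Type} {IsoF : Frd → Frd → Type} {Ob : Frd → Type} {realify : Frd → Frd} {Strip : Type}
  {IsoS : Strip → Strip → Type}
  {Mv : ∀ v : (thetaIndex (pilotDataOfK D K)).V, v ∈ (thetaIndex (pilotDataOfK D K)).Vbad → Type} [∀ v h, Monoid (Mv v h)]
  (sig : GlobalLGPFrobenioidSignature (thetaIndex (pilotDataOfK D K)).lstar (thetaIndex (pilotDataOfK D K)).V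
    (· ∈ (thetaIndex (pilotDataOfK D K)).Vbad) Frd IsoF Ob realify Strip IsoS Mv)
  (split : SplittingMonoids Mv) {ObΔ : Type}
  {N : ∀ v : (thetaIndex (pilotDataOfK D K)).V, v ∈ (thetaIndex (pilotDataOfK D K)).Vbad → Type} [∀ v h, Monoid (N v h)]
  (qData : QPilotData ObΔ N)
  (tq : ∀ (pp : Nat.Primes) (x : (thetaIndex (pilotDataOfK D K)).Fibre (.inr pp)),
    haveI : Fact (pp : ℕ).Prime := ⟨pp.2⟩; kOf (pilotDataOfK D K) pp.1 x)
  (t : ∀ (pp : Nat.Primes) (_ : Fin (pilotDataOfK D K).lstar) (x : (thetaIndex (pilotDataOfK D K)).Fibre (.inr pp)),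
    haveI : Fact (pp : ℕ).Prime := ⟨pp.2⟩; kOf (pilotDataOfK D K) pp.1 x)
  (htq0 : ∀ pp x, tq pp x ≠ 0)
  (htq1 : ∀ (pp : Nat.Primes) (x : (thetaIndex (pilotDataOfK D K)).Fibre (.inr pp)),
    haveI : Fact (pp : ℕ).Prime := ⟨pp.2⟩; placeOf (pilotDataOfK D K) pp.1 x ∉ (pilotDataOfK D K).S → ‖tq pp x‖ = 1)

/-- **The K-level Θ-side bound WITHOUT the archimedean term**: at abc-iut-c312-7's print-normalised sharp real setting over `K` of the pilot
datum of `D`, for ANY q-ideles `tq` and EVERY Θ-idele `t` realising `P_Θ` (`ht0`, `hT`), and any genuine Θ-volume input `I` of `D`: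
`(settingPrVolSharp (pilotDataOfK D K) … tq t _ _).negLogTheta ≤ ↑I.negLogThetaNonarch` — the setting's archimedean Θ-term is `0`
(trivial container), so abc-iut-s2-p7's content-hull bound p446007 with `A := 0` on `Tp := T(I)`, identified prime by prime with abc-iut-S2's
`negLogThetaLoc p` (abc-iut-s2-p6 `procAvg_sum_weightPr_content_below_eq_negLogThetaLoc`), gives the NONARCHIMEDEAN genuine number as the bound.
[cite: Mochizuki2012, IUTchIV Thm. 1.10 Steps (v)–(viii) p. 27–30] [cite: DupuyHilado2025, §1 (1.1), Def. 3.6.3] -/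
theorem negLogTheta_settingPrVolSharp_pilotDataOfK_le_negLogThetaNonarch (ht0 : ∀ pp i x, t pp i x ≠ 0)
    (hT : ∀ (pp : Nat.Primes) (i : Fin (pilotDataOfK D K).lstar) (x : (thetaIndex (pilotDataOfK D K)).Fibre (.inr pp)),
      haveI : Fact (pp : ℕ).Prime := ⟨pp.2⟩
      Real.log ‖t pp i x‖ = -((pilotDataOfK D K).thetaPilot i (placeOf (pilotDataOfK D K) pp.1 x)) *
        logNorm K (placeOf (pilotDataOfK D K) pp.1 x) / localDegree K (placeOf (pilotDataOfK D K) pp.1 x))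
    {I : ThetaVolumeInput (fieldOfModuli E) K} (hI : IsVolumeInputOf D I) :
    (settingPrVolSharp (pilotDataOfK D K) (logvAnalytic_analyticLogv (F := K)) M archPk archSub Ψ act Mmod region n lat
        sig split qData tq t htq0 htq1).negLogTheta ≤ ((I.negLogThetaNonarch : ℝ) : WithTop ℝ) := by
  obtain ⟨r, rfl⟩ := exists_eq_volumeInputOf D hI
  obtain ⟨mgen, hmgen⟩ := (volumeInputOf D r).exists_contentFamily
  have hTp : ∀ pp ∈ ((volumeInputOf D r).supportPrimes.subtype Nat.Prime : Finset Nat.Primes),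
      (pp : ℕ) ∈ (volumeInputOf D r).supportPrimes := fun pp hpp => Finset.mem_subtype.mp hpp
  have hTp' : ∀ pp : Nat.Primes,
      ((pp : ℕ) ∣ 2 * (NumberField.discr K).natAbs ∨ ∃ v ∈ (pilotDataOfK D K).S, ((pp : ℕ) : 𝓞 K) ∈ v.asIdeal) →
        pp ∈ ((volumeInputOf D r).supportPrimes.subtype Nat.Prime : Finset Nat.Primes) :=
    fun pp h => Finset.mem_subtype.mpr (mem_supportPrimes_of_dvd_or_mem D r pp h)
  -- p446007 with `A := 0`
  have key := negLogTheta_settingPrVolSharp_pilotDataOfK_le_sum_content_below D r mgen hmgen t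
    (logvAnalytic_analyticLogv (F := K)) M archPk archSub Ψ act Mmod region n lat sig split qData tq ht0 hT htq0 htq1
    ((volumeInputOf D r).supportPrimes.subtype Nat.Prime : Finset Nat.Primes) hTp hTp' (le_refl (0 : ℝ))
  refine key.trans (le_of_eq ?_)
  congr 1
  rw [add_zero, ThetaVolumeInput.negLogThetaNonarch, ← Finset.sum_subtype_of_mem (fun p => (volumeInputOf D r).negLogThetaLoc p)
    (fun p hp => (volumeInputOf D r).prime_of_mem_supportPrimes hp)]
  refine Finset.sum_congr rfl fun pp hpp => ?_
  exact procAvg_sum_weightPr_content_below_eq_negLogThetaLoc D r pp (hTp pp hpp) mgen hmgen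

/-- **The K-level READ binder is ALWAYS STRICT**: `(settingPrVolSharp (pilotDataOfK D K) … tq t _ _).negLogTheta < ↑I.negLogTheta` for EVERY realising
Θ-idele, ANY q-ideles and any genuine input `I` of `D` — the genuine number exceeds its nonarchimedean part by `archLogTheta l = ((l+5)/4)·log π > 0`
(abc-iut-S2 `archLogTheta_pos`). So the «(or =)» alternative of the R2 mint's TARGET #2 is false for these typings at the K level (as at the M
level, abc-iut-s2-p8/s2-p9): `hΘ` of v6K/v7K is a `<`. [cite: Mochizuki2012, IUTchIV Thm. 1.10 Step (vii) p. 30] [cite: Mochizuki2012, IUTchIII Cor. 3.12 p. 173–174] -/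
theorem negLogTheta_settingPrVolSharp_pilotDataOfK_lt_genuine (ht0 : ∀ pp i x, t pp i x ≠ 0)
    (hT : ∀ (pp : Nat.Primes) (i : Fin (pilotDataOfK D K).lstar) (x : (thetaIndex (pilotDataOfK D K)).Fibre (.inr pp)),
      haveI : Fact (pp : ℕ).Prime := ⟨pp.2⟩
      Real.log ‖t pp i x‖ = -((pilotDataOfK D K).thetaPilot i (placeOf (pilotDataOfK D K) pp.1 x)) *
        logNorm K (placeOf (pilotDataOfK D K) pp.1 x) / localDegree K (placeOf (pilotDataOfK D K) pp.1 x))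
    {I : ThetaVolumeInput (fieldOfModuli E) K} (hI : IsVolumeInputOf D I) :
    (settingPrVolSharp (pilotDataOfK D K) (logvAnalytic_analyticLogv (F := K)) M archPk archSub Ψ act Mmod region n lat
        sig split qData tq t htq0 htq1).negLogTheta < ((I.negLogTheta : ℝ) : WithTop ℝ) := by
  refine lt_of_le_of_lt (negLogTheta_settingPrVolSharp_pilotDataOfK_le_negLogThetaNonarch D M archPk archSub Ψ act Mmod region n lat
    sig split qData tq t htq0 htq1 ht0 hT hI) (WithTop.coe_lt_coe.mpr ?_)
  unfold ThetaVolumeInput.negLogTheta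
  linarith [ThetaVolumeInput.archLogTheta_pos I.l]

/-- **… hence never an equality**: `(settingPrVolSharp (pilotDataOfK D K) … tq t _ _).negLogTheta ≠ ↑I.negLogTheta`.
[cite: Mochizuki2012, IUTchIV Thm. 1.10 Step (vii) p. 30] -/
theorem negLogTheta_settingPrVolSharp_pilotDataOfK_ne_genuine (ht0 : ∀ pp i x, t pp i x ≠ 0)
    (hT : ∀ (pp : Nat.Primes) (i : Fin (pilotDataOfK D K).lstar) (x : (thetaIndex (pilotDataOfK D K)).Fibre (.inr pp)),
      haveI : Fact (pp : ℕ).Prime := ⟨pp.2⟩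
      Real.log ‖t pp i x‖ = -((pilotDataOfK D K).thetaPilot i (placeOf (pilotDataOfK D K) pp.1 x)) *
        logNorm K (placeOf (pilotDataOfK D K) pp.1 x) / localDegree K (placeOf (pilotDataOfK D K) pp.1 x))
    {I : ThetaVolumeInput (fieldOfModuli E) K} (hI : IsVolumeInputOf D I) :
    (settingPrVolSharp (pilotDataOfK D K) (logvAnalytic_analyticLogv (F := K)) M archPk archSub Ψ act Mmod region n lat
        sig split qData tq t htq0 htq1).negLogTheta ≠ ((I.negLogTheta : ℝ) : WithTop ℝ) :=
  ne_of_lt (negLogTheta_settingPrVolSharp_pilotDataOfK_lt_genuine D M archPk archSub Ψ act Mmod region n lat sig split qData tq t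
    htq0 htq1 ht0 hT hI)

end Strict

/-! ## At a genuine Θ-volume DATUM (the binder shape of the K-level certificates) -/

/-- **At a datum `T : Cor22.ThetaVolumeDatumAt P l`**: for every context of abc-iut-c312-7's sharp setting over `T.K`, any q-ideles and EVERY
realising Θ-idele, `(settingPrVolSharp (pilotDataOfK T.D T.K) … tq t _ _).negLogTheta < ↑T.negLogTheta` — the `hΘ` binder of `abc_of_SH_v7K` /
`hΘw` of the window certificates holds STRICTLY; «=» never. [cite: Mochizuki2012, IUTchIV Thm. 1.10 Step (vii) p. 30]
[cite: Mochizuki2012, IUTchIII Cor. 3.12 p. 173–174] -/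
theorem negLogTheta_settingPrVolSharp_pilotDataOfK_lt_datum
    {P : Literature.NumberTheory.DiophantineGeometry.GenEll.NFPoint} {l : ℕ} (T : Cor22.ThetaVolumeDatumAt P l) :
    letI := T.instFieldF; letI := T.instNumberFieldF; letI := T.instAlgebraF; letI := T.instFieldK;
    letI := T.instNumberFieldK; letI := T.instAlgebraK; letI := T.instFieldFbar; letI := T.instAlgebraFbar;
    letI := T.instAlgebraKFbar; letI := T.instIsElliptic;
    ∀ (M : Type) [Field M] [NumberField M]
      (archPk : ∀ (j : (thetaIndex (pilotDataOfK T.D T.K)).Label) (vQ : (thetaIndex (pilotDataOfK T.D T.K)).VQ),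
        Set ((logShellsDH (pilotDataOfK T.D T.K) (analyticLogv T.K)).Packet j vQ))
      (archSub : ∀ (j : (thetaIndex (pilotDataOfK T.D T.K)).Label) (v : (thetaIndex (pilotDataOfK T.D T.K)).V),
        Set ((logShellsDH (pilotDataOfK T.D T.K) (analyticLogv T.K)).Packet j ((thetaIndex (pilotDataOfK T.D T.K)).over v)))
      (Ψ : ℤ → ∀ v : (thetaIndex (pilotDataOfK T.D T.K)).V, v ∈ (thetaIndex (pilotDataOfK T.D T.K)).Vbad →
        Set ((logShellsDH (pilotDataOfK T.D T.K) (analyticLogv T.K)).StarPacket v))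
      (act : ℤ → ∀ v : (thetaIndex (pilotDataOfK T.D T.K)).V, v ∈ (thetaIndex (pilotDataOfK T.D T.K)).Vbad →
        (logShellsDH (pilotDataOfK T.D T.K) (analyticLogv T.K)).StarPacket v →
          Module.End ℚ ((logShellsDH (pilotDataOfK T.D T.K) (analyticLogv T.K)).StarPacket v))
      (Mmod : ℤ → ∀ j : (thetaIndex (pilotDataOfK T.D T.K)).LabelStar,
        Set ((logShellsDH (pilotDataOfK T.D T.K) (analyticLogv T.K)).GlobalPacket j.1))
      (region : ℤ → ∀ j : (thetaIndex (pilotDataOfK T.D T.K)).LabelStar, FinDivisor M →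
        ∀ vQ : (thetaIndex (pilotDataOfK T.D T.K)).VQ, Set ((logShellsDH (pilotDataOfK T.D T.K) (analyticLogv T.K)).Packet j.1 vQ))
      (n : ℤ) {HT : Type} {LogLink : HT → HT → Type} {IsFull : ∀ {s t : HT}, LogLink s t → Prop}
      (lat : LGPGaussianLogThetaLattice LogLink IsFull)
      {Frd : Type} {IsoF : Frd → Frd → Type} {Ob : Frd → Type} {realify : Frd → Frd} {Strip : Type}
      {IsoS : Strip → Strip → Type}
      {Mv : ∀ v : (thetaIndex (pilotDataOfK T.D T.K)).V, v ∈ (thetaIndex (pilotDataOfK T.D T.K)).Vbad → Type}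
      [∀ v h, Monoid (Mv v h)]
      (sig : GlobalLGPFrobenioidSignature (thetaIndex (pilotDataOfK T.D T.K)).lstar (thetaIndex (pilotDataOfK T.D T.K)).V
        (· ∈ (thetaIndex (pilotDataOfK T.D T.K)).Vbad) Frd IsoF Ob realify Strip IsoS Mv)
      (split : SplittingMonoids Mv) {ObΔ : Type}
      {N : ∀ v : (thetaIndex (pilotDataOfK T.D T.K)).V, v ∈ (thetaIndex (pilotDataOfK T.D T.K)).Vbad → Type} [∀ v h, Monoid (N v h)]
      (qData : QPilotData ObΔ N)
      (tq : ∀ (pp : Nat.Primes) (x : (thetaIndex (pilotDataOfK T.D T.K)).Fibre (.inr pp)),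
        haveI : Fact (pp : ℕ).Prime := ⟨pp.2⟩; kOf (pilotDataOfK T.D T.K) pp.1 x)
      (t : ∀ (pp : Nat.Primes) (_ : Fin (pilotDataOfK T.D T.K).lstar) (x : (thetaIndex (pilotDataOfK T.D T.K)).Fibre (.inr pp)),
        haveI : Fact (pp : ℕ).Prime := ⟨pp.2⟩; kOf (pilotDataOfK T.D T.K) pp.1 x)
      (htq0 : ∀ pp x, tq pp x ≠ 0)
      (htq1 : ∀ (pp : Nat.Primes) (x : (thetaIndex (pilotDataOfK T.D T.K)).Fibre (.inr pp)),
        haveI : Fact (pp : ℕ).Prime := ⟨pp.2⟩; placeOf (pilotDataOfK T.D T.K) pp.1 x ∉ (pilotDataOfK T.D T.K).S → ‖tq pp x‖ = 1),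
      (∀ pp i x, t pp i x ≠ 0) →
      (∀ (pp : Nat.Primes) (i : Fin (pilotDataOfK T.D T.K).lstar) (x : (thetaIndex (pilotDataOfK T.D T.K)).Fibre (.inr pp)),
        haveI : Fact (pp : ℕ).Prime := ⟨pp.2⟩
        Real.log ‖t pp i x‖ = -((pilotDataOfK T.D T.K).thetaPilot i (placeOf (pilotDataOfK T.D T.K) pp.1 x)) *
          logNorm T.K (placeOf (pilotDataOfK T.D T.K) pp.1 x) / localDegree T.K (placeOf (pilotDataOfK T.D T.K) pp.1 x)) →
      (settingPrVolSharp (pilotDataOfK T.D T.K) (logvAnalytic_analyticLogv (F := T.K)) M archPk archSub Ψ act Mmod region n lat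
          sig split qData tq t htq0 htq1).negLogTheta < ((T.negLogTheta : ℝ) : WithTop ℝ) := by
  intro M _ _ archPk archSub Ψ act Mmod region n HT LogLink IsFull lat Frd IsoF Ob realify Strip IsoS Mv _ sig split ObΔ N _ qData
    tq t htq0 htq1 ht0 hT
  letI := T.instFieldF; letI := T.instNumberFieldF; letI := T.instAlgebraF; letI := T.instFieldK
  letI := T.instNumberFieldK; letI := T.instAlgebraK; letI := T.instFieldFbar; letI := T.instAlgebraFbar
  letI := T.instAlgebraKFbar; letI := T.instIsElliptic
  exact negLogTheta_settingPrVolSharp_pilotDataOfK_lt_genuine T.D M archPk archSub Ψ act Mmod region n lat sig split qData tq t htq0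
    htq1 ht0 hT T.isVolumeInputOf

end Summit.ABC.IUTFork.Cor312Prov

end
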